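import Literature.Probability.RandomPlanarGeometry.SLETraceMarkov
import Literature.Probability.RandomPlanarGeometry.SLETraceZeroOne
import Literature.Probability.RandomPlanarGeometry.BrownianStrongMarkov
import HarnessLib

/-!
# The conformal Markov property of the SLE trace at a stopping time

Topic `Probability/RandomPlanarGeometry`; theorems and one definition. The tree proves the Markov
property of the chordal SLE_κ trace at FIXED times (`SLETraceMarkov.lean`: law and independence of
the shifted trace `γˢ`, the identification `γ(s + u) = Fₛ(γˢ(u) + W(s))`) and the STRONG Markov
property of Brownian motion (`BrownianStrongMarkov.lean`: for a stopping time `τ` of the raw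
Brownian filtration, `Z^τ_u = B_{τ+u} - B_τ` is a Brownian motion independent of `𝓕ᵂ_τ`, with
the freezing formula `E[F(X, Z^τ)] = E_ω[E_{ω'}[F(X(ω), B(ω'))]]`). This file combines them into
the **conformal Markov property of the trace at a stopping time** (Rohde–Schramm (2005), §7,
p. 911; Lawler (2005), §6.2–6.3; Beffara (2008), §3: "Apply the Markov property at the first
hitting time `T_ε(z)` of `B(z, ε)`"), in the forms consumed by hitting estimates after `τ`:

* `sleTraceAfter κ τ ω = trace (u ↦ √κ Z^τ_u(ω))` — the trace `γ^τ` of the increments after `τ`;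
* `ae_exists_isGeneratedByCurve_incrAfter` — under `HasSLETrace κ`, a.s. the chain of
  `√κ Z^τ` is generated by a curve (the generation event is the preimage of ONE measurable set of
  paths under the Brownian path, of probability `1`, and `Z^τ` has the law of `B`);
* `ae_sleTrace_add_eq_extendFrom_stoppingTime` — a.s., for all `u`,
  `γ(τ + u) = F_τ(γ^τ(u) + W(τ))` (`F_τ` the continuous extension of `g_τ⁻¹` to the closed
  half-plane; the deterministic identification `IsGeneratedByCurve.apply_add_eq_extendFrom`);
* `integral_sleTraceAfter_eq_integral_integral` — **freezing formula for the trace**: for `X`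
  `𝓕ᵂ_τ`-measurable and `F` bounded jointly measurable,
  `E[F(X, γ^τ)] = E_ω[E_{ω'}[F(X(ω), γ(ω'))]]` (`γ = sleTrace κ`): conditionally on `𝓕ᵂ_τ`, the
  trace after `τ` is a fresh SLE_κ trace;
* (restricted to `A ∩ {τ < ∞}` throughout: `τ` need not be a.s. finite — hitting times of
  discs by the trace are not).

## References

* S. Rohde, O. Schramm, *Basic properties of SLE*, Ann. of Math. 161 (2005), Prop. 2.1 (ii), §7
  p. 911.
* G. F. Lawler, *Conformally Invariant Processes in the Plane*, AMS (2005), §6.2 (the curves `γˢ`),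
  §6.3.
* V. Beffara, *The dimension of the SLE curves*, Ann. Probab. 36 (2008), §3 (Markov property at
  the hitting time of a disc).
* J.-F. Le Gall, *Brownian Motion, Martingales, and Stochastic Calculus* (2016), Thm. 2.20.
-/

noncomputable section

open Set Filter Topology MeasureTheory ProbabilityTheory Complex
open UpperHalfPlane (upperHalfPlaneSet isOpen_upperHalfPlaneSet)
open scoped NNReal

namespace Literature.Probability.RandomPlanarGeometry

open scoped PathBorel

variable {κ : ℝ≥0} {τ : (ℝ≥0 → ℝ) → WithTop ℝ≥0}

/-! ### The trace after a stopping time -/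

variable (κ) in
/-- **The driving increments after `τ`**: `u ↦ √κ Z^τ_u = W(τ + u) - W(τ)` (read where `τ < ∞`).
[cite: Lawler2005, §6.2] -/
def sleDrivingAfter (τ : (ℝ≥0 → ℝ) → WithTop ℝ≥0) (ω : ℝ≥0 → ℝ) (u : ℝ≥0) : ℝ :=
  Real.sqrt κ * brownianIncrAfter τ u ω

variable (κ) in
/-- **The trace after `τ`**: the trace `γ^τ` of the chain driven by `√κ Z^τ` (junk when that chain
is not generated by a curve). [cite: Lawler2005, §6.2] -/
def sleTraceAfter (τ : (ℝ≥0 → ℝ) → WithTop ℝ≥0) (ω : ℝ≥0 → ℝ) : ℝ≥0 → ℂ :=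
  Loewner.trace (sleDrivingAfter κ τ ω)

/-- `√κ Z^τ_u = W(τ + u) - W(τ)` where `τ = r`. [folklore] -/
theorem sleDrivingAfter_of_eq_coe {ω : ℝ≥0 → ℝ} {r : ℝ≥0} (h : τ ω = r) (u : ℝ≥0) :
    sleDrivingAfter κ τ ω u = sleDriving κ ω (r + u) - sleDriving κ ω r := by
  rw [sleDrivingAfter, brownianIncrAfter_of_eq_coe h, sleDriving, sleDriving, mul_sub]

/-- The driving increments after `τ` have continuous paths. [folklore] -/
theorem continuous_sleDrivingAfter (ω : ℝ≥0 → ℝ) : Continuous (sleDrivingAfter κ τ ω) :=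
  continuous_const.mul (continuous_brownianIncrAfter τ ω)

/-- `sleDrivingAfter` is the `√κ`-multiple of the path `Z^τ`. [folklore] -/
theorem sleDrivingAfter_eq_smul (ω : ℝ≥0 → ℝ) :
    sleDrivingAfter κ τ ω = fun u ↦ Real.sqrt κ * (fun u ↦ brownianIncrAfter τ u ω) u := rfl

/-! ### The generation event as the preimage of one measurable set of paths -/

/-- **One measurable set of paths carries the generation event**: there is a measurable
`S ⊆ (ℝ≥0 → ℝ)` such that for every CONTINUOUS path `w`, `w ∈ S` iff the chain of `√κ w` is
generated by a curve (the Borel set of [LSW04] Lemma 3.14 / `measurableSet_snd_image_generatedPairs`,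
pulled back from `C(ℝ≥0, ℝ)` to the raw path space, `Process.borel_continuousMap_eq_iSup_comap_eval`).
[folklore] -/
theorem exists_measurableSet_generated (κ : ℝ≥0) :
    ∃ S : Set (ℝ≥0 → ℝ), MeasurableSet S ∧ ∀ w : ℝ≥0 → ℝ, Continuous w →
      (w ∈ S ↔ ∃ γ, Loewner.IsGeneratedByCurve (fun t ↦ Real.sqrt κ * w t) γ) := by
  set T : Set C(ℝ≥0, ℝ) :=
    {F | ∃ γ, Loewner.IsGeneratedByCurve (fun t ↦ Real.sqrt κ * F t) γ} with hT
  have hsm : Measurable fun F : C(ℝ≥0, ℝ) ↦ (Real.sqrt κ : ℝ) • F :=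
    Process.measurable_continuousMap_of_eval fun t ↦
      (continuous_eval_const t).measurable.const_mul _
  have hTm : MeasurableSet T := by
    have h : T = (fun F : C(ℝ≥0, ℝ) ↦ (Real.sqrt κ : ℝ) • F) ⁻¹' (Prod.snd '' generatedPairs) := by
      ext F
      simp only [hT, mem_setOf_eq, mem_preimage, mem_image, Prod.exists, exists_eq_right,
        mem_generatedPairs, ContinuousMap.coe_smul]
      constructor
      · rintro ⟨γ, hγ⟩
        exact ⟨⟨γ, hγ.continuous⟩, hγ⟩
      · rintro ⟨γ, hγ⟩
        exact ⟨γ, hγ⟩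
    rw [h]
    exact hsm measurableSet_snd_image_generatedPairs
  have hle : (borel C(ℝ≥0, ℝ) : MeasurableSpace C(ℝ≥0, ℝ)) ≤
      MeasurableSpace.comap (fun (F : C(ℝ≥0, ℝ)) (t : ℝ≥0) ↦ F t) MeasurableSpace.pi := by
    rw [Process.borel_continuousMap_eq_iSup_comap_eval, Process.iSup_comap_eval_eq_comap_pi]
  obtain ⟨S, hS, hST⟩ := MeasurableSpace.measurableSet_comap.1 (hle _ hTm)
  refine ⟨S, hS, fun w hw ↦ ?_⟩
  have h : (⇑(⟨w, hw⟩ : C(ℝ≥0, ℝ)) ∈ S ↔ (⟨w, hw⟩ : C(ℝ≥0, ℝ)) ∈ T) := by rw [← hST]; rfl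
  simp only [ContinuousMap.coe_mk] at h
  rw [h]
  rfl

/-! ### Generation of the chain after `τ`, almost surely on `{τ < ∞}` -/

/-- **The generation event after `τ` on `A ∩ {τ < ∞}` has the probability of `A ∩ {τ < ∞}`**
(`HasSLETrace κ`, `A ∈ 𝓕ᵂ_τ`): `{√κ Z^τ generated} = (Z^τ)⁻¹ S`, `{√κ B generated} = B⁻¹ S` has
probability `1`, and `P[Z^τ ∈ S, A, τ < ∞] = P[B ∈ S] P[A, τ < ∞]`
(`measure_brownianIncrAfter_mem_inter`). [folklore] -/
theorem measure_generatedAfter_inter (h0 : HasSLETrace κ) (hτ : IsStoppingTime brownianFiltration τ)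
    {A : Set (ℝ≥0 → ℝ)} (hA : MeasurableSet[hτ.measurableSpace] A) :
    Process.preWienerMeasure ({ω | ∃ γ, Loewner.IsGeneratedByCurve (sleDrivingAfter κ τ ω) γ} ∩
        (A ∩ {ω | τ ω ≠ ⊤})) = Process.preWienerMeasure (A ∩ {ω | τ ω ≠ ⊤}) := by
  haveI := isProbabilityMeasure_preWienerMeasure'
  obtain ⟨S, hS, hSiff⟩ := exists_measurableSet_generated κ
  have hB : Process.preWienerMeasure ((fun ω u ↦ Process.brownian u ω) ⁻¹' S) = 1 := by
    have h1 : {ω | ∃ γ, Loewner.IsGeneratedByCurve (sleDriving κ ω) γ} =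
        (fun ω u ↦ Process.brownian u ω) ⁻¹' S := by
      ext ω
      rw [mem_preimage, hSiff _ (Process.continuous_brownian ω)]
      rfl
    have h2 : ∀ᵐ ω ∂Process.preWienerMeasure,
        ω ∈ {ω | ∃ γ, Loewner.IsGeneratedByCurve (sleDriving κ ω) γ} := h0
    rw [h1] at h2
    exact (mem_ae_iff_prob_eq_one (measurable_brownian_pi hS)).1 h2
  have hZ : {ω | ∃ γ, Loewner.IsGeneratedByCurve (sleDrivingAfter κ τ ω) γ} =
      (fun ω u ↦ brownianIncrAfter τ u ω) ⁻¹' S := by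
    ext ω
    rw [mem_preimage, hSiff _ (continuous_brownianIncrAfter τ ω)]
    rfl
  rw [hZ, measure_brownianIncrAfter_mem_inter hτ hA hS, hB, one_mul]

/-- The generation event after `τ` is measurable. [folklore] -/
theorem measurableSet_generatedAfter (hτ : IsStoppingTime brownianFiltration τ) :
    MeasurableSet {ω | ∃ γ, Loewner.IsGeneratedByCurve (sleDrivingAfter κ τ ω) γ} := by
  obtain ⟨S, hS, hSiff⟩ := exists_measurableSet_generated κ
  have hZ : {ω | ∃ γ, Loewner.IsGeneratedByCurve (sleDrivingAfter κ τ ω) γ} =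
      (fun ω u ↦ brownianIncrAfter τ u ω) ⁻¹' S := by
    ext ω
    rw [mem_preimage, hSiff _ (continuous_brownianIncrAfter τ ω)]
    rfl
  rw [hZ]
  exact measurable_brownianIncrAfter_pi hτ.measurable' hS

/-- **Almost surely on `{τ < ∞}`, the chain of `√κ Z^τ` is generated by a curve** (`HasSLETrace κ`,
any stopping time `τ`): Rohde–Schramm's Thm. 5.1 transported to the Brownian motion `Z^τ` by the
strong Markov property. [cite: RohdeSchramm2005, Thm 5.1] -/
theorem ae_exists_isGeneratedByCurve_incrAfter (h0 : HasSLETrace κ)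
    (hτ : IsStoppingTime brownianFiltration τ) :
    ∀ᵐ ω ∂Process.preWienerMeasure, τ ω ≠ ⊤ →
      ∃ γ, Loewner.IsGeneratedByCurve (sleDrivingAfter κ τ ω) γ := by
  haveI := isProbabilityMeasure_preWienerMeasure'
  set G := {ω : ℝ≥0 → ℝ | ∃ γ, Loewner.IsGeneratedByCurve (sleDrivingAfter κ τ ω) γ} with hG
  set N := {ω : ℝ≥0 → ℝ | τ ω ≠ ⊤} with hN
  have hGm : MeasurableSet G := measurableSet_generatedAfter hτ
  have hNm : MeasurableSet N := measurableSet_ne_top hτ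
  have h1 := measure_generatedAfter_inter (κ := κ) h0 hτ (@MeasurableSet.univ _ hτ.measurableSpace)
  rw [Set.univ_inter] at h1
  -- `P(N \ G) = 0`
  have hnull : Process.preWienerMeasure (N \ G) = 0 := by
    have h2 : Process.preWienerMeasure (N \ G) + Process.preWienerMeasure (N ∩ G) = Process.preWienerMeasure N :=
      measure_sdiff_add_inter N hGm
    rw [Set.inter_comm, h1] at h2
    have hfin : Process.preWienerMeasure N ≠ ⊤ := measure_ne_top _ _
    calc Process.preWienerMeasure (N \ G)
        = Process.preWienerMeasure (N \ G) + Process.preWienerMeasure N - Process.preWienerMeasure N :=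
          (ENNReal.add_sub_cancel_right hfin).symm
      _ = Process.preWienerMeasure N - Process.preWienerMeasure N := by rw [h2]
      _ = 0 := tsub_self _
  rw [ae_iff]
  refine measure_mono_null (fun ω hω ↦ ?_) hnull
  simp only [mem_setOf_eq, Classical.not_imp] at hω
  exact ⟨hω.1, hω.2⟩

/-! ### The identification `γ(τ + u) = F_τ(γ^τ(u) + W(τ))` -/

/-- **The Markov decomposition of the SLE trace at a stopping time.** Under `HasSLETrace κ`, for a
stopping time `τ` of the raw Brownian filtration: a.s., if `τ = r < ∞` then for all `u`,
`γ(r + u) = F_r(γ^τ(u) + W(r))`, with `γ = sleTrace κ ω`, `γ^τ = sleTraceAfter κ τ ω` and `F_r` the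
continuous extension of `g_r⁻¹` to the closed half-plane
(`Loewner.IsGeneratedByCurve.apply_add_eq_extendFrom`). Lawler (2005), §6.2; Rohde–Schramm (2005),
p. 911; Beffara (2008), §3. [cite: Lawler2005, §6.2] -/
theorem ae_sleTrace_add_eq_extendFrom_stoppingTime (h0 : HasSLETrace κ)
    (hτ : IsStoppingTime brownianFiltration τ) :
    ∀ᵐ ω ∂Process.preWienerMeasure, ∀ r : ℝ≥0, τ ω = r → ∀ u : ℝ≥0,
      sleTrace κ ω (r + u) = extendFrom upperHalfPlaneSet (Loewner.loewnerInv (sleDriving κ ω) r)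
        (sleTraceAfter κ τ ω u + sleDriving κ ω r) := by
  filter_upwards [h0, ae_exists_isGeneratedByCurve_incrAfter h0 hτ] with ω hω hωτ r hr u
  have hgen := hωτ (by rw [hr]; exact WithTop.coe_ne_top)
  have heq : sleDrivingAfter κ τ ω = fun u ↦ sleDriving κ ω (r + u) - sleDriving κ ω r :=
    funext fun u ↦ sleDrivingAfter_of_eq_coe hr u
  have hγs : Loewner.IsGeneratedByCurve (fun u ↦ sleDriving κ ω (r + u) - sleDriving κ ω r)
      (sleTraceAfter κ τ ω) := by
    rw [sleTraceAfter, heq]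
    rw [heq] at hgen
    exact Loewner.isGeneratedByCurve_trace hgen
  exact (Loewner.isGeneratedByCurve_trace hω).apply_add_eq_extendFrom (continuous_sleDriving κ ω) hγs u

/-! ### The freezing formula for the trace after `τ`, restricted to `A ∩ {τ < ∞}` -/

section Freezing

variable {𝒳 : Type*} [MeasurableSpace 𝒳]

/-- **Product structure on `A ∩ {τ < ∞}`**: for `A ∈ 𝓕ᵂ_τ` and `X` `𝓕ᵂ_τ`-measurable, the image of
`P|_{A ∩ {τ<∞}}` under `(X, Z^τ)` is the product of the image of `P|_{A ∩ {τ<∞}}` under `X` with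
the law of the Brownian path (rectangles: `measure_brownianIncrAfter_mem_inter` with the event
`A ∩ X⁻¹U ∈ 𝓕ᵂ_τ`; then `Measure.prod_eq`). [cite: Legall2016, Thm. 2.20] -/
theorem map_pair_restrict_eq_prod (hτ : IsStoppingTime brownianFiltration τ)
    {X : (ℝ≥0 → ℝ) → 𝒳} (hX : Measurable[hτ.measurableSpace] X) {A : Set (ℝ≥0 → ℝ)}
    (hA : MeasurableSet[hτ.measurableSpace] A) :
    (Process.preWienerMeasure.restrict (A ∩ {ω | τ ω ≠ ⊤})).map
        (fun ω ↦ (X ω, fun u ↦ brownianIncrAfter τ u ω)) =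
      ((Process.preWienerMeasure.restrict (A ∩ {ω | τ ω ≠ ⊤})).map X).prod
        (Process.preWienerMeasure.map fun ω u ↦ Process.brownian u ω) := by
  haveI := isProbabilityMeasure_preWienerMeasure'
  set ν := Process.preWienerMeasure.restrict (A ∩ {ω | τ ω ≠ ⊤}) with hν
  have hZm : Measurable fun (ω : ℝ≥0 → ℝ) (u : ℝ≥0) ↦ brownianIncrAfter τ u ω :=
    measurable_brownianIncrAfter_pi hτ.measurable'
  have hXm : Measurable X := hX.mono hτ.measurableSpace_le le_rfl
  have hAm : MeasurableSet (A ∩ {ω | τ ω ≠ ⊤}) := (hτ.measurableSpace_le _ hA).inter (measurableSet_ne_top hτ)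
  haveI : IsFiniteMeasure ν := by rw [hν]; infer_instance
  haveI : IsFiniteMeasure (ν.map X) := Measure.isFiniteMeasure_map _ _
  haveI : IsProbabilityMeasure (Process.preWienerMeasure.map fun (ω : ℝ≥0 → ℝ) (u : ℝ≥0) ↦ Process.brownian u ω) :=
    Measure.isProbabilityMeasure_map measurable_brownian_pi.aemeasurable
  symm
  refine Measure.prod_eq fun U S hU hS ↦ ?_
  rw [Measure.map_apply (hXm.prodMk hZm) (hU.prod hS), Measure.map_apply hXm hU,
    Measure.map_apply measurable_brownian_pi hS, hν, Measure.restrict_apply (hXm hU),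
    Measure.restrict_apply ((hXm.prodMk hZm) (hU.prod hS))]
  have hA' : MeasurableSet[hτ.measurableSpace] (A ∩ X ⁻¹' U) := hA.inter (hX hU)
  have h := measure_brownianIncrAfter_mem_inter hτ hA' hS
  have hset : (fun ω ↦ (X ω, fun u ↦ brownianIncrAfter τ u ω)) ⁻¹' U ×ˢ S ∩ (A ∩ {ω | τ ω ≠ ⊤}) =
      (fun ω u ↦ brownianIncrAfter τ u ω) ⁻¹' S ∩ (A ∩ X ⁻¹' U ∩ {ω | τ ω ≠ ⊤}) := by
    ext ω; simp only [mem_inter_iff, mem_preimage, mem_prod, mem_setOf_eq]; tauto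
  have hset' : X ⁻¹' U ∩ (A ∩ {ω | τ ω ≠ ⊤}) = A ∩ X ⁻¹' U ∩ {ω | τ ω ≠ ⊤} := by
    ext ω; simp only [mem_inter_iff, mem_preimage, mem_setOf_eq]; tauto
  rw [hset, h, hset', mul_comm]

/-- **Freezing formula for the driving increments after `τ`, restricted to `A ∩ {τ < ∞}`**: for
`A ∈ 𝓕ᵂ_τ`, `X` `𝓕ᵂ_τ`-measurable and `F` bounded jointly measurable,
`E[F(X, Z^τ); A, τ < ∞] = E[ E_{ω'}[F(X(ω), B(ω'))] ; A, τ < ∞]` (no a.s. finiteness of `τ`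
needed). [cite: Legall2016, Thm. 2.20] -/
theorem setIntegral_brownianIncrAfter_eq_setIntegral_integral (hτ : IsStoppingTime brownianFiltration τ)
    {X : (ℝ≥0 → ℝ) → 𝒳} (hX : Measurable[hτ.measurableSpace] X) {F : 𝒳 → (ℝ≥0 → ℝ) → ℝ}
    (hFm : Measurable (Function.uncurry F)) {C : ℝ} (hFb : ∀ x w, |F x w| ≤ C) {A : Set (ℝ≥0 → ℝ)}
    (hA : MeasurableSet[hτ.measurableSpace] A) :
    ∫ ω in A ∩ {ω | τ ω ≠ ⊤}, F (X ω) (fun u ↦ brownianIncrAfter τ u ω) ∂Process.preWienerMeasure =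
      ∫ ω in A ∩ {ω | τ ω ≠ ⊤}, (∫ ω', F (X ω) (fun u ↦ Process.brownian u ω') ∂Process.preWienerMeasure)
        ∂Process.preWienerMeasure := by
  haveI := isProbabilityMeasure_preWienerMeasure'
  set ν := Process.preWienerMeasure.restrict (A ∩ {ω | τ ω ≠ ⊤}) with hν
  set Z : (ℝ≥0 → ℝ) → ℝ≥0 → ℝ := fun ω u ↦ brownianIncrAfter τ u ω with hZ
  have hZm : Measurable Z := measurable_brownianIncrAfter_pi hτ.measurable'
  have hXm : Measurable X := hX.mono hτ.measurableSpace_le le_rfl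
  haveI : IsFiniteMeasure ν := by rw [hν]; infer_instance
  haveI : IsFiniteMeasure (ν.map X) := Measure.isFiniteMeasure_map _ _
  haveI : IsProbabilityMeasure (Process.preWienerMeasure.map fun (ω : ℝ≥0 → ℝ) (u : ℝ≥0) ↦ Process.brownian u ω) :=
    Measure.isProbabilityMeasure_map measurable_brownian_pi.aemeasurable
  have hFint : ∀ (μ : Measure (𝒳 × (ℝ≥0 → ℝ))) [IsFiniteMeasure μ],
      Integrable (Function.uncurry F) μ := fun μ _ ↦
    (integrable_const C).mono' hFm.aestronglyMeasurable (Eventually.of_forall fun p ↦ by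
      rw [Real.norm_eq_abs]; exact hFb p.1 p.2)
  have hpair := map_pair_restrict_eq_prod hτ hX hA
  have h1 : ∫ ω, F (X ω) (Z ω) ∂ν = ∫ p, Function.uncurry F p ∂(ν.map fun ω ↦ (X ω, Z ω)) := by
    rw [integral_map (hXm.prodMk hZm).aemeasurable hFm.aestronglyMeasurable]
    rfl
  change ∫ ω, F (X ω) (Z ω) ∂ν = ∫ ω, (∫ ω', F (X ω) (fun u ↦ Process.brownian u ω') ∂Process.preWienerMeasure) ∂ν
  rw [h1, hpair, integral_prod _ (hFint _)]
  have h3 : ∀ x : 𝒳, ∫ w, Function.uncurry F (x, w)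
      ∂(Process.preWienerMeasure.map fun ω u ↦ Process.brownian u ω) =
      ∫ ω', F x (fun u ↦ Process.brownian u ω') ∂Process.preWienerMeasure := fun x ↦ by
    rw [integral_map measurable_brownian_pi.aemeasurable]
    · rfl
    · exact (hFm.comp (measurable_const.prodMk measurable_id)).aestronglyMeasurable
  simp_rw [h3]
  rw [integral_map hXm.aemeasurable]
  refine (Measurable.stronglyMeasurable ?_).aestronglyMeasurable
  exact (hFm.comp (measurable_fst.prodMk (measurable_brownian_pi.comp
    measurable_snd))).stronglyMeasurable.integral_prod_right' |>.measurable

/-- **The conformal Markov property of the SLE trace at a stopping time (freezing form).** Under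
`HasSLETrace κ`, for a stopping time `τ` of the raw Brownian filtration, `A ∈ 𝓕ᵂ_τ`, `X`
`𝓕ᵂ_τ`-measurable and `F` bounded and jointly measurable on `𝒳 × (ℝ≥0 → ℂ)`:
`E[F(X, γ^τ); A, τ < ∞] = E[ E_{ω'}[F(X(ω), γ(ω'))] ; A, τ < ∞]`, `γ = sleTrace κ`,
`γ^τ = sleTraceAfter κ τ`: conditionally on `𝓕ᵂ_τ` and on `{τ < ∞}`, the trace of the increments
after `τ` is a fresh SLE_κ trace (and `γ(τ + ·) = F_τ(γ^τ + W(τ))`,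
`ae_sleTrace_add_eq_extendFrom_stoppingTime`). Rohde–Schramm (2005), §7 p. 911; Lawler (2005),
§6.2–6.3; Beffara (2008), §3 ("apply the Markov property at the first hitting time `T_ε(z)`").
[cite: RohdeSchramm2005, Prop. 2.1] -/
theorem setIntegral_sleTraceAfter_eq_setIntegral_integral (h0 : HasSLETrace κ)
    (hτ : IsStoppingTime brownianFiltration τ) {X : (ℝ≥0 → ℝ) → 𝒳}
    (hX : Measurable[hτ.measurableSpace] X) {F : 𝒳 → (ℝ≥0 → ℂ) → ℝ}
    (hFm : Measurable (Function.uncurry F)) {C : ℝ} (hFb : ∀ x γ, |F x γ| ≤ C) {A : Set (ℝ≥0 → ℝ)}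
    (hA : MeasurableSet[hτ.measurableSpace] A) :
    ∫ ω in A ∩ {ω | τ ω ≠ ⊤}, F (X ω) (sleTraceAfter κ τ ω) ∂Process.preWienerMeasure =
      ∫ ω in A ∩ {ω | τ ω ≠ ⊤}, (∫ ω', F (X ω) (sleTrace κ ω') ∂Process.preWienerMeasure)
        ∂Process.preWienerMeasure := by
  haveI := isProbabilityMeasure_preWienerMeasure'
  obtain ⟨T, hTm, hT⟩ := Loewner.exists_measurable_eq_trace
  have hsc : Measurable fun (w : ℝ≥0 → ℝ) (u : ℝ≥0) ↦ Real.sqrt κ * w u :=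
    measurable_pi_lambda _ fun u ↦ (measurable_pi_apply u).const_mul _
  set F' : 𝒳 → (ℝ≥0 → ℝ) → ℝ := fun x w ↦ F x (T fun u ↦ Real.sqrt κ * w u) with hF'
  have hF'm : Measurable (Function.uncurry F') :=
    hFm.comp (measurable_fst.prodMk ((hTm.comp hsc).comp measurable_snd))
  have hF'b : ∀ x w, |F' x w| ≤ C := fun x w ↦ hFb x _
  have h := setIntegral_brownianIncrAfter_eq_setIntegral_integral hτ hX hF'm hF'b hA
  have hAm : MeasurableSet (A ∩ {ω | τ ω ≠ ⊤}) := (hτ.measurableSpace_le _ hA).inter (measurableSet_ne_top hτ)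
  -- left side: `F'(X, Z^τ) = F(X, γ^τ)` a.e. on `A ∩ {τ < ∞}`
  have hL : ∀ᵐ ω ∂Process.preWienerMeasure, ω ∈ A ∩ {ω | τ ω ≠ ⊤} →
      F' (X ω) (fun u ↦ brownianIncrAfter τ u ω) = F (X ω) (sleTraceAfter κ τ ω) := by
    filter_upwards [ae_exists_isGeneratedByCurve_incrAfter h0 hτ] with ω hω hωA
    have hgen := hω hωA.2
    simp only [hF', sleTraceAfter]
    rw [show (fun u ↦ Real.sqrt κ * brownianIncrAfter τ u ω) = sleDrivingAfter κ τ ω from rfl,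
      hT _ (continuous_sleDrivingAfter ω) hgen]
  -- right side: `F'(x, B ω') = F(x, γ(ω'))` for a.e. `ω'`
  have hR : ∀ x : 𝒳, ∫ ω', F' x (fun u ↦ Process.brownian u ω') ∂Process.preWienerMeasure =
      ∫ ω', F x (sleTrace κ ω') ∂Process.preWienerMeasure := by
    intro x
    refine integral_congr_ae ?_
    filter_upwards [h0] with ω' hω'
    simp only [hF']
    rw [show (fun u ↦ Real.sqrt κ * Process.brownian u ω') = sleDriving κ ω' from rfl,
      hT _ (continuous_sleDriving κ ω') hω']
    rfl
  rw [← setIntegral_congr_ae hAm hL, h]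
  exact setIntegral_congr_fun hAm fun ω _ ↦ hR (X ω)

end Freezing

end Literature.Probability.RandomPlanarGeometry
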